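import Literature.AlgebraicGeometry.Pohlmann1968.CMTypeRankCharactersNumberField
import Mathlib.RingTheory.RootsOfUnity.Complex
import HarnessLib

/-!
# Dodson's converse of Ribet's theorem: primitive DEGENERATE CM types of rank `n − l + 2` on the group
# `⟨ρ⟩ × ℤ/n` for every factorisation `n = kl`, `k ≥ 3`, `l ≥ 2` (Dodson 1984, §3.1.1 and §3.2.1), group level

B. Dodson, *The structure of Galois groups of CM-fields*, Trans. Amer. Math. Soc. **283** (1984) 1–32 [Dodson1984]
(held text `paper:doi-10-2307-1999987`, pp. 11–13), §3 "Degeneracy in composite dimensions":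

> §3.2.1 "THEOREM (A Converse of Ribet's Theorem [15]).  Let `n > 4` be composite and factor `n` as `n = kl`, with
> `k ≥ 3`, `l ≥ 2`.  Then there exist simple degenerate Abelian varieties of dimension `n` and rank `n − l + 2`.
> *Proof.* Observe that there exist cyclic totally real fields for every `n`, so there exist CM-fields `K` with `K/ℚ`
> Abelian and `Gal(K/ℚ) = ⟨ρ⟩ × ℤₙ = G`.  Normalize the ρ-structure so that `G₀ = ℤₙ` is given by `G₀ = ⟨σ⟩`,
> `σ = (1 2 ⋯ n)`, and consider the type defined by `f = ((1, …, 1), 0_l, …, 0_l)`, written in `k` blocks, each with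
> `l` entries. […] Then `r = (k − 1)l + 1` in the constant weight criterion, so `rank(K, Φᶠ) = n − l + 2` […].
> Finally, note that `Φ` is primitive since the orbit of `f` under `G` has order `2n`, with `K/ℚ` Abelian."

and the "constant weight criterion" it invokes, §3.1.1: "Suppose the CM-field `K` has an imaginary quadratic subfield,
and let `G₀ = Gal(K₀ᶜ/ℚ)` […] `G = ⟨ρ⟩ × G₀`. Let `Φ = Φᶠ`, `f ∈ (ℤ₂)ⁿ`, be a CM-type on `K` and let `r` be the rank
of the `ℤ`-span of the orbit `G₀*(f)` […]. Then `t(Φ) = r + 1`, unless the weight of `f` is `n/2`, in which case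
`t(Φ) = r` may also occur."  (Ribet's theorem [15] = [Ribet1980] §3: a simple abelian variety of CM type and PRIME
dimension is nondegenerate — the tree's `typeRank_eq_of_prime_of_isPrimitive` in `CMTypeRank.lean`.)

This file is the GROUP-LEVEL content, in the abstract setting of the tree's `CMTypeRank.lean` /
`CMTypeRankCharacters.lean` (a finite commutative group `G` acting on itself by translation; `typeRank`,
`IsCMTypeWith`): `G` is a finite commutative group with an involution `ρ ≠ 1` and an element `σ` of order `n` such
that `ρ ∉ ⟨σ⟩` and `|G| = 2n` — so that `G = ⟨ρ⟩ × ⟨σ⟩ ≅ ℤ/2 × ℤ/n`, Dodson's `⟨ρ⟩ × ℤₙ` — and Dodson's type `Φᶠ`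
for the block vector `f = (1_l, 0, …, 0)` (up to the cyclic shift Dodson's `((1,…,1), 0_l, …, 0_l)`) is the set
`Φ = {σⁱ : l ≤ i < n} ∪ {ρσⁱ : 0 ≤ i < l}`, characterised below by the two membership rules
`σⁱ ∈ Φ ↔ l ≤ i mod n` and `ρσⁱ ∈ Φ ↔ i mod n < l` (hypotheses `hΦσ`, `hΦρ`; such a `Φ` exists, `exists_blockType`).

PROVED here (all statements are Dodson's, the proofs go through Kubota's character formula — tree theorem
`IsCMTypeWith.typeRank_add_ncard_oddCharacters_vanishing`, [Kubota1965] §4 Lemma 2 — instead of Dodson's row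
reduction of the circulant matrix `M`, which is the same computation in the Fourier basis):

* `isCMTypeWith_blockType` — `Φ` is a CM type for `ρ`;
* `sum_oddChar_blockType_eq` — for an odd character `χ` (`χ(ρ) = −1`), `ω = χ(σ)`:
  `Σ_{s ∈ Φ} χ(s) = Σ_{i<n} ωⁱ − 2 Σ_{i<l} ωⁱ` (the character form of the constant weight criterion: the odd
  characters of `⟨ρ⟩ × G₀` are `sgn ⊗ ψ`, and `χ(Φᶠ) = ψ(G₀) − 2ψ(f)`), which for `2l ≠ n` vanishes iff `ωˡ = 1 ≠ ω`
  (`blockSum_eq_zero_iff`);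
* `ncard_oddChar_vanishing_blockType` — exactly `l − 1` odd characters vanish on `Φ` (`χ ↦ χ(σ)` is a bijection
  from the odd characters onto the `n`-th roots of unity, `image_oddChar_eq_rootsOfUnity`);
* the rank `n − l + 2`, the primitivity ("the orbit of `f` under `G` has order `2n`") and the packaged §3.2.1 are in
  the sequel `DegenerateCMTypesCompositeDimensionRank.lean` (split for size only).

The number-field dress (an abelian CM field `K` with `Gal(K/ℚ) = ⟨ρ⟩ × ⟨σ⟩`: a primitive `Motives.CMType K` of
`cmTypeRank = n − l + 2`, its realisations simple degenerate abelian `n`-folds with exceptional Hodge classes) is the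
companion `AlgebraicGeometry/Pohlmann1968/SimpleDegenerateCMAbelianVarietiesCompositeDimension.lean`.  Theorems only; no
definition, no named fact (D-0014/D-0026).  Written for the COR-CM cell of the Hodge summit (`pub-hodgecm2`, literature
seat Deligne 1982 / CM-type combinatorics, claim DODSON-CONVERSE): the complement of Ribet–Yanai (prime dimension ⟹
nondegenerate, `typeRank_eq_of_prime`) — in EVERY composite dimension `n > 4` simple CM abelian varieties with
exceptional Hodge classes exist.

## References

* [Dodson1984] B. Dodson, *The structure of Galois groups of CM-fields*, Trans. AMS 283 (1984), §3.1.1 (constant weight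
  criterion), §3.2.1 Theorem (A Converse of Ribet's Theorem) with proof, pp. 11–13.
* [Kubota1965] T. Kubota, *On the field extension by complex multiplication*, Trans. AMS 118 (1965), §4 Lemma 2.
* [Ribet1980] K. Ribet, *Division fields of abelian varieties with complex multiplication*, Mém. SMF 2 (1980), §3.
* [Gordon1999HodgeAVSurvey] B. B. Gordon, *A survey of the Hodge conjecture for abelian varieties*, §9.4.
-/

set_option autoImplicit false

noncomputable section

open scoped BigOperators

namespace Literature.NumberTheory.ComplexMultiplication

open Literature.AlgebraicGeometry.Pohlmann1968 (two_mul_ncard_oddCharacters_eq_card)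

namespace Dodson1984

variable {G : Type*} [CommGroup G] [Fintype G] {ρ σ : G} {n l : ℕ}

/-! ### §1 The group `G = ⟨ρ⟩ × ⟨σ⟩` -/

omit [Fintype G] in
/-- In `⟨ρ⟩ × ⟨σ⟩` no element `ρσʲ` is a power of `σ` (`ρ ∉ ⟨σ⟩`). [folklore] -/
private theorem rho_mul_pow_ne_pow (hρσ : ρ ∉ Subgroup.zpowers σ) (i j : ℕ) : ρ * σ ^ j ≠ σ ^ i := by
  intro h
  apply hρσ
  have : ρ = σ ^ i * (σ ^ j)⁻¹ := by rw [← h, mul_inv_cancel_right]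
  rw [this]
  exact mul_mem (pow_mem (Subgroup.mem_zpowers σ) i) (inv_mem (pow_mem (Subgroup.mem_zpowers σ) j))

/-- **`G = ⟨σ⟩ ⊔ ρ⟨σ⟩`**: for `σ` of order `n`, `ρ ∉ ⟨σ⟩` and `|G| = 2n`, the map `(i ↦ σⁱ) ⊔ (i ↦ ρσⁱ)` on
`Fin n ⊕ Fin n` is a bijection onto `G` (Dodson's identification `G = ⟨ρ⟩ × ℤₙ`). [cite: Dodson1984, §3.2.1 (proof)] -/
theorem powOrRhoPow_bijective (hσ : orderOf σ = n) (hρσ : ρ ∉ Subgroup.zpowers σ)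
    (hcard : Fintype.card G = 2 * n) :
    Function.Bijective (fun x : Fin n ⊕ Fin n =>
      Sum.elim (fun i : Fin n => σ ^ (i : ℕ)) (fun i : Fin n => ρ * σ ^ (i : ℕ)) x) := by
  have key : ∀ a b : ℕ, a < n → b < n → σ ^ a = σ ^ b → a = b := fun a b ha hb hab =>
    pow_injOn_Iio_orderOf (by rw [Set.mem_Iio, hσ]; exact ha) (by rw [Set.mem_Iio, hσ]; exact hb) hab
  have hinj : Function.Injective (fun x : Fin n ⊕ Fin n =>
      Sum.elim (fun i : Fin n => σ ^ (i : ℕ)) (fun i : Fin n => ρ * σ ^ (i : ℕ)) x) := by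
    rintro (a | a) (b | b) hab <;> simp only [Sum.elim_inl, Sum.elim_inr] at hab
    · exact congrArg Sum.inl (Fin.ext (key _ _ a.isLt b.isLt hab))
    · exact absurd hab.symm (rho_mul_pow_ne_pow hρσ _ _)
    · exact absurd hab (rho_mul_pow_ne_pow hρσ _ _)
    · exact congrArg Sum.inr (Fin.ext (key _ _ a.isLt b.isLt (mul_left_cancel hab)))
  rw [Fintype.bijective_iff_injective_and_card]
  exact ⟨hinj, by rw [Fintype.card_sum, Fintype.card_fin, hcard, two_mul]⟩

/-- Every element of `G = ⟨ρ⟩ × ⟨σ⟩` is `σⁱ` or `ρσⁱ` with `i < n`. [cite: Dodson1984, §3.2.1 (proof)] -/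
theorem exists_eq_pow_or_eq_rho_mul_pow (hσ : orderOf σ = n) (hρσ : ρ ∉ Subgroup.zpowers σ)
    (hcard : Fintype.card G = 2 * n) (g : G) : ∃ i : ℕ, i < n ∧ (g = σ ^ i ∨ g = ρ * σ ^ i) := by
  obtain ⟨x, hx⟩ := (powOrRhoPow_bijective hσ hρσ hcard).2 g
  rcases x with i | i
  · exact ⟨i, i.isLt, Or.inl (by simpa using hx.symm)⟩
  · exact ⟨i, i.isLt, Or.inr (by simpa using hx.symm)⟩

omit [Fintype G] in
/-- `σⁱ = σʲ ↔ i ≡ j (mod n)` for `σ` of order `n`. [folklore] -/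
private theorem pow_eq_pow_iff_mod_eq (hσ : orderOf σ = n) (i j : ℕ) : σ ^ i = σ ^ j ↔ i % n = j % n := by
  rw [pow_eq_pow_iff_modEq, hσ]; rfl

/-! ### §2 Dodson's block type `Φ = {σⁱ : l ≤ i < n} ∪ {ρσⁱ : i < l}` -/

omit [Fintype G] in
/-- **Dodson's type `Φᶠ`, `f = (1_l, 0, …, 0)`, exists on `⟨ρ⟩ × ⟨σ⟩`**: a finite set `Φ ⊆ G` with
`σⁱ ∈ Φ ↔ l ≤ i mod n` and `ρσⁱ ∈ Φ ↔ i mod n < l` ("consider the type defined by `f = ((1,…,1), 0_l, …, 0_l)`").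
[cite: Dodson1984, §3.2.1 (proof)] -/
theorem exists_blockType [Fintype G] (hσ : orderOf σ = n) (hρσ : ρ ∉ Subgroup.zpowers σ) (l : ℕ) :
    ∃ Φ : Finset G, (∀ i : ℕ, σ ^ i ∈ Φ ↔ l ≤ i % n) ∧ (∀ i : ℕ, ρ * σ ^ i ∈ Φ ↔ i % n < l) := by
  classical
  refine ⟨Finset.univ.filter fun g =>
      ∃ j : ℕ, (g = σ ^ j ∧ l ≤ j % n) ∨ (g = ρ * σ ^ j ∧ j % n < l), fun i => ?_, fun i => ?_⟩
  · simp only [Finset.mem_filter, Finset.mem_univ, true_and]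
    constructor
    · rintro ⟨j, (⟨hj, hjl⟩ | ⟨hj, -⟩)⟩
      · rwa [(pow_eq_pow_iff_mod_eq hσ i j).1 hj]
      · exact absurd hj.symm (rho_mul_pow_ne_pow hρσ i j)
    · exact fun h => ⟨i, Or.inl ⟨rfl, h⟩⟩
  · simp only [Finset.mem_filter, Finset.mem_univ, true_and]
    constructor
    · rintro ⟨j, (⟨hj, -⟩ | ⟨hj, hjl⟩)⟩
      · exact absurd hj (rho_mul_pow_ne_pow hρσ j i)
      · rwa [(pow_eq_pow_iff_mod_eq hσ i j).1 (mul_left_cancel hj)]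
    · exact fun h => ⟨i, Or.inr ⟨rfl, h⟩⟩

section BlockType

variable {Φ : Finset G}

/-- **`Φᶠ` is a CM type for `ρ`** (it contains exactly one of `x`, `ρx` for every `x ∈ G = ⟨σ⟩ ⊔ ρ⟨σ⟩`).
[cite: Dodson1984, §3.2.1 (proof)] -/
theorem isCMTypeWith_blockType (hρ2 : ρ * ρ = 1) (hσ : orderOf σ = n) (hρσ : ρ ∉ Subgroup.zpowers σ)
    (hcard : Fintype.card G = 2 * n) (hΦσ : ∀ i : ℕ, σ ^ i ∈ Φ ↔ l ≤ i % n)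
    (hΦρ : ∀ i : ℕ, ρ * σ ^ i ∈ Φ ↔ i % n < l) : IsCMTypeWith ρ (Φ : Set G) := by
  refine ⟨fun x => ?_, fun g x => ?_, fun x => ?_⟩
  · obtain ⟨i, -, rfl | rfl⟩ := exists_eq_pow_or_eq_rho_mul_pow hσ hρσ hcard x
    · rw [Finset.mem_coe, smul_eq_mul, Finset.mem_coe, hΦσ, hΦρ, not_lt]
    · rw [Finset.mem_coe, smul_eq_mul, ← mul_assoc, hρ2, one_mul, Finset.mem_coe, hΦρ, hΦσ, not_le]
  · change g * (ρ * x) = ρ * (g * x)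
    rw [mul_left_comm]
  · change ρ * (ρ * x) = x
    rw [← mul_assoc, hρ2, one_mul]

/-! ### §3 The constant weight criterion in character form: odd character sums over `Φᶠ` -/

omit [Fintype G] in
/-- `χ(gᵉ) = χ(g)ᵉ`. [folklore] -/
private theorem char_pow (χ : AddChar (Additive G) ℂ) (g : G) (e : ℕ) :
    χ (Additive.ofMul (g ^ e)) = χ (Additive.ofMul g) ^ e := by
  rw [ofMul_pow, AddChar.map_nsmul_eq_pow]

omit [Fintype G] in
/-- `χ(gh) = χ(g)χ(h)`. [folklore] -/
private theorem char_mul (χ : AddChar (Additive G) ℂ) (g h : G) :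
    χ (Additive.ofMul (g * h)) = χ (Additive.ofMul g) * χ (Additive.ofMul h) := by
  rw [ofMul_mul, AddChar.map_add_eq_mul]

omit [Fintype G] in
/-- `χ(σ)ⁿ = 1` for `σ` of order `n`. [folklore] -/
private theorem char_pow_orderOf_eq_one (hσ : orderOf σ = n) (χ : AddChar (Additive G) ℂ) :
    χ (Additive.ofMul σ) ^ n = 1 := by
  rw [← char_pow, ← hσ, pow_orderOf_eq_one, ofMul_one, AddChar.map_zero_eq_one]

/-- **The odd character sums over Dodson's type** (the constant weight criterion §3.1.1 in Kubota's character form: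
the odd characters of `⟨ρ⟩ × ⟨σ⟩` are `ρᵃσⁱ ↦ (−1)ᵃωⁱ`, `ωⁿ = 1`, and `Σ_{s∈Φᶠ} χ(s) = Σ_{i ∉ f} ωⁱ − Σ_{i ∈ f} ωⁱ`):
for `χ(ρ) = −1` and `ω = χ(σ)`, `Σ_{s ∈ Φ} χ(s) = Σ_{i<n} (ωⁱ if l ≤ i, else −ωⁱ)`.
[cite: Dodson1984, §3.1.1 Theorem and §3.2.1 (proof)] -/
theorem sum_oddChar_blockType_eq_ite (hσ : orderOf σ = n) (hρσ : ρ ∉ Subgroup.zpowers σ)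
    (hcard : Fintype.card G = 2 * n) (hΦσ : ∀ i : ℕ, σ ^ i ∈ Φ ↔ l ≤ i % n)
    (hΦρ : ∀ i : ℕ, ρ * σ ^ i ∈ Φ ↔ i % n < l) (χ : AddChar (Additive G) ℂ)
    (hχ : χ (Additive.ofMul ρ) = -1) :
    ∑ s ∈ Φ, χ (Additive.ofMul s) =
      ∑ i ∈ Finset.range n,
        (if l ≤ i then χ (Additive.ofMul σ) ^ i else -(χ (Additive.ofMul σ) ^ i)) := by
  classical
  set ω : ℂ := χ (Additive.ofMul σ) with hω_def
  let e : Fin n ⊕ Fin n → G := fun x =>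
    Sum.elim (fun i : Fin n => σ ^ (i : ℕ)) (fun i : Fin n => ρ * σ ^ (i : ℕ)) x
  have hbij : Function.Bijective e := powOrRhoPow_bijective hσ hρσ hcard
  have h1 : ∑ s ∈ Φ, χ (Additive.ofMul s) = ∑ g : G, if g ∈ Φ then χ (Additive.ofMul g) else 0 := by
    rw [← Finset.sum_filter, Finset.filter_mem_eq_inter, Finset.univ_inter]
  have h2 : (∑ g : G, if g ∈ Φ then χ (Additive.ofMul g) else 0) =
      ∑ x : Fin n ⊕ Fin n, if e x ∈ Φ then χ (Additive.ofMul (e x)) else 0 :=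
    (Fintype.sum_bijective e hbij (fun x => if e x ∈ Φ then χ (Additive.ofMul (e x)) else 0)
      (fun g => if g ∈ Φ then χ (Additive.ofMul g) else 0) fun _ => rfl).symm
  rw [h1, h2, Fintype.sum_sum_type, ← Finset.sum_add_distrib, Finset.sum_range]
  refine Finset.sum_congr rfl fun i _ => ?_
  have hi : (i : ℕ) % n = i := Nat.mod_eq_of_lt i.isLt
  change ((if σ ^ (i : ℕ) ∈ Φ then χ (Additive.ofMul (σ ^ (i : ℕ))) else 0) +
      if ρ * σ ^ (i : ℕ) ∈ Φ then χ (Additive.ofMul (ρ * σ ^ (i : ℕ))) else 0) =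
      if l ≤ (i : ℕ) then ω ^ (i : ℕ) else -(ω ^ (i : ℕ))
  by_cases hli : l ≤ (i : ℕ)
  · have hm1 : σ ^ (i : ℕ) ∈ Φ := (hΦσ i).2 (by rwa [hi])
    have hm2 : ρ * σ ^ (i : ℕ) ∉ Φ := fun h => by
      have h' := (hΦρ i).1 h
      rw [hi] at h'
      exact absurd hli (not_le.2 h')
    rw [if_pos hm1, if_neg hm2, if_pos hli, add_zero, char_pow]
  · have hm1 : σ ^ (i : ℕ) ∉ Φ := fun h => by
      have h' := (hΦσ i).1 h
      rw [hi] at h'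
      exact hli h'
    have hm2 : ρ * σ ^ (i : ℕ) ∈ Φ := (hΦρ i).2 (by rw [hi]; exact not_le.1 hli)
    rw [if_neg hm1, if_pos hm2, if_neg hli, zero_add, char_mul, char_pow, hχ, neg_one_mul]

/-- `Σ_{i<n} (ωⁱ if l ≤ i, else −ωⁱ) = Σ_{i<n} ωⁱ − 2 Σ_{i<l} ωⁱ` for `l ≤ n`. [folklore] -/
private theorem sum_range_ite_eq (ω : ℂ) (hl : l ≤ n) :
    ∑ i ∈ Finset.range n, (if l ≤ i then ω ^ i else -(ω ^ i)) =
      ∑ i ∈ Finset.range n, ω ^ i - 2 * ∑ i ∈ Finset.range l, ω ^ i := by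
  have h1 : ∀ i : ℕ, (if l ≤ i then ω ^ i else -(ω ^ i)) = ω ^ i - 2 * (if i < l then ω ^ i else 0) := by
    intro i
    by_cases h : l ≤ i
    · rw [if_pos h, if_neg (not_lt.2 h), mul_zero, sub_zero]
    · rw [if_neg h, if_pos (not_le.1 h)]; ring
  have h2 : (Finset.range n).filter (fun i => i < l) = Finset.range l := by
    ext i
    simp only [Finset.mem_filter, Finset.mem_range]
    omega
  simp_rw [h1]
  rw [Finset.sum_sub_distrib, ← Finset.mul_sum, ← Finset.sum_filter, h2]

/-- **When does the block sum vanish?**  For `ωⁿ = 1`, `l ≤ n` and `2l ≠ n`: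
`Σ_{i<n} ωⁱ − 2 Σ_{i<l} ωⁱ = 0 ↔ ωˡ = 1 ∧ ω ≠ 1` (for `ω = 1` the sum is `n − 2l ≠ 0`; for `ω ≠ 1` it is
`−2(ωˡ − 1)/(ω − 1)`) — Dodson: the last `l` rows of the circulant matrix `M` reduce to `(0, …, 0, I₁ + I₂)`,
`r = (k − 1)l + 1`. [cite: Dodson1984, §3.2.1 (proof)] -/
theorem blockSum_eq_zero_iff (ω : ℂ) (hωn : ω ^ n = 1) (h2l : 2 * l ≠ n) :
    (∑ i ∈ Finset.range n, ω ^ i - 2 * ∑ i ∈ Finset.range l, ω ^ i = 0) ↔ (ω ^ l = 1 ∧ ω ≠ 1) := by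
  by_cases hω : ω = 1
  · subst hω
    simp only [one_pow, Finset.sum_const, Finset.card_range, nsmul_eq_mul, mul_one, ne_eq,
      not_true_eq_false, and_false, iff_false, sub_eq_zero]
    intro h
    apply h2l
    exact_mod_cast h.symm
  · rw [geom_sum_eq hω, hωn, sub_self, zero_div, zero_sub, geom_sum_eq hω, neg_eq_zero, mul_eq_zero,
      div_eq_zero_iff, sub_eq_zero, sub_eq_zero]
    constructor
    · rintro (h | h | h)
      · norm_num at h
      · exact ⟨h, hω⟩
      · exact absurd h hω
    · rintro ⟨h, -⟩
      exact Or.inr (Or.inl h)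

/-! ### §4 Counting the odd characters vanishing on `Φᶠ` -/

/-- **An odd character of `⟨ρ⟩ × ⟨σ⟩` is determined by its value at `σ`.** [folklore] -/
private theorem oddChar_injOn (hσ : orderOf σ = n) (hρσ : ρ ∉ Subgroup.zpowers σ) (hcard : Fintype.card G = 2 * n) :
    Set.InjOn (fun χ : AddChar (Additive G) ℂ => χ (Additive.ofMul σ))
      {χ : AddChar (Additive G) ℂ | χ (Additive.ofMul ρ) = -1} := by
  intro χ₁ h₁ χ₂ h₂ heq
  simp only [Set.mem_setOf_eq] at h₁ h₂ heq
  refine DFunLike.ext _ _ fun x => ?_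
  obtain ⟨i, -, hx | hx⟩ := exists_eq_pow_or_eq_rho_mul_pow hσ hρσ hcard (Additive.toMul x)
  · have : x = Additive.ofMul (σ ^ i) := by rw [← hx]; rfl
    rw [this, char_pow, char_pow, heq]
  · have : x = Additive.ofMul (ρ * σ ^ i) := by rw [← hx]; rfl
    rw [this, char_mul, char_mul, char_pow, char_pow, h₁, h₂, heq]

/-- There are exactly `n` odd characters (`|G| = 2n`; tree `two_mul_ncard_oddCharacters_eq_card`).
[cite: Kubota1965, §4 Lemma 2 (proof)] -/
theorem ncard_oddChar (hρ1 : ρ ≠ 1) (hρ2 : ρ * ρ = 1) (hcard : Fintype.card G = 2 * n) :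
    {χ : AddChar (Additive G) ℂ | χ (Additive.ofMul ρ) = -1}.ncard = n := by
  have h := two_mul_ncard_oddCharacters_eq_card (G := G) hρ1 hρ2
  rw [hcard] at h
  omega

/-- The `m`-th roots of unity in `ℂ` as a set are the finset `nthRootsFinset m 1`. [folklore] -/
private theorem setOf_pow_eq_one_eq_coe_nthRootsFinset {m : ℕ} (hm : 0 < m) :
    {ω : ℂ | ω ^ m = 1} = ↑(Polynomial.nthRootsFinset m (1 : ℂ)) := by
  ext ω
  rw [Set.mem_setOf_eq, Finset.mem_coe, Polynomial.mem_nthRootsFinset hm]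

/-- `#{ω ∈ ℂ : ωᵐ = 1} = m` (`m ≥ 1`). [folklore] -/
private theorem ncard_setOf_pow_eq_one {m : ℕ} (hm : 0 < m) : {ω : ℂ | ω ^ m = 1}.ncard = m := by
  rw [setOf_pow_eq_one_eq_coe_nthRootsFinset hm, Set.ncard_coe_finset,
    (Complex.isPrimitiveRoot_exp m hm.ne').card_nthRootsFinset]

/-- **`χ ↦ χ(σ)` maps the odd characters ONTO the `n`-th roots of unity** (injective, both sets have `n` elements).
[folklore] -/
private theorem image_oddChar_eq_rootsOfUnity (hρ1 : ρ ≠ 1) (hρ2 : ρ * ρ = 1) (hσ : orderOf σ = n)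
    (hρσ : ρ ∉ Subgroup.zpowers σ) (hcard : Fintype.card G = 2 * n) (hn : 0 < n) :
    (fun χ : AddChar (Additive G) ℂ => χ (Additive.ofMul σ)) ''
        {χ : AddChar (Additive G) ℂ | χ (Additive.ofMul ρ) = -1} = {ω : ℂ | ω ^ n = 1} := by
  apply Set.eq_of_subset_of_ncard_le
  · rintro _ ⟨χ, -, rfl⟩
    exact char_pow_orderOf_eq_one hσ χ
  · rw [(oddChar_injOn hσ hρσ hcard).ncard_image, ncard_oddChar hρ1 hρ2 hcard,
      ncard_setOf_pow_eq_one hn]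
  · rw [setOf_pow_eq_one_eq_coe_nthRootsFinset hn]
    exact Finset.finite_toSet _

/-- **Exactly `l − 1` odd characters vanish on Dodson's type** (`l ∣ n`, `0 < l`, `2l ≠ n`): those with
`χ(σ)ˡ = 1 ≠ χ(σ)` — Dodson's defect `n + 1 − t(Φ) = l − 1`. [cite: Dodson1984, §3.2.1 (proof)] -/
theorem ncard_oddChar_vanishing_blockType (hρ1 : ρ ≠ 1) (hρ2 : ρ * ρ = 1) (hσ : orderOf σ = n)
    (hρσ : ρ ∉ Subgroup.zpowers σ) (hcard : Fintype.card G = 2 * n)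
    (hΦσ : ∀ i : ℕ, σ ^ i ∈ Φ ↔ l ≤ i % n) (hΦρ : ∀ i : ℕ, ρ * σ ^ i ∈ Φ ↔ i % n < l)
    (hl : 0 < l) (hln : l ∣ n) (h2l : 2 * l ≠ n) :
    {χ : AddChar (Additive G) ℂ | χ (Additive.ofMul ρ) = -1 ∧ ∑ s ∈ Φ, χ (Additive.ofMul s) = 0}.ncard
      = l - 1 := by
  have hn : 0 < n := hσ ▸ orderOf_pos σ
  have hl' : l ≤ n := Nat.le_of_dvd hn hln
  set ev : AddChar (Additive G) ℂ → ℂ := fun χ => χ (Additive.ofMul σ) with hev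
  -- the vanishing odd characters are the odd characters with `χ(σ)ˡ = 1 ≠ χ(σ)`
  have hV : {χ : AddChar (Additive G) ℂ | χ (Additive.ofMul ρ) = -1 ∧ ∑ s ∈ Φ, χ (Additive.ofMul s) = 0} =
      {χ : AddChar (Additive G) ℂ | χ (Additive.ofMul ρ) = -1} ∩ ev ⁻¹' {ω : ℂ | ω ^ l = 1 ∧ ω ≠ 1} := by
    ext χ
    simp only [Set.mem_setOf_eq, Set.mem_inter_iff, Set.mem_preimage, hev]
    refine and_congr_right fun hχ => ?_
    rw [sum_oddChar_blockType_eq_ite hσ hρσ hcard hΦσ hΦρ χ hχ, sum_range_ite_eq _ hl',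
      blockSum_eq_zero_iff _ (char_pow_orderOf_eq_one hσ χ) h2l]
  -- transport the count along `χ ↦ χ(σ)`
  have hinj : Set.InjOn ev ({χ : AddChar (Additive G) ℂ | χ (Additive.ofMul ρ) = -1} ∩
      ev ⁻¹' {ω : ℂ | ω ^ l = 1 ∧ ω ≠ 1}) := (oddChar_injOn hσ hρσ hcard).mono Set.inter_subset_left
  rw [hV, ← hinj.ncard_image, Set.image_inter_preimage, hev, image_oddChar_eq_rootsOfUnity hρ1 hρ2 hσ hρσ hcard hn]
  -- the `n`-th roots of unity `ω` with `ωˡ = 1 ≠ ω` are the `l`-th roots of unity other than `1`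
  have hset : {ω : ℂ | ω ^ n = 1} ∩ {ω : ℂ | ω ^ l = 1 ∧ ω ≠ 1} = {ω : ℂ | ω ^ l = 1} \ {1} := by
    ext ω
    simp only [Set.mem_inter_iff, Set.mem_setOf_eq, Set.mem_sdiff, Set.mem_singleton_iff]
    constructor
    · rintro ⟨-, h1, h2⟩
      exact ⟨h1, h2⟩
    · rintro ⟨h1, h2⟩
      obtain ⟨c, rfl⟩ := hln
      exact ⟨by rw [pow_mul, h1, one_pow], h1, h2⟩
  rw [hset, Set.ncard_sdiff_singleton_of_mem (by simp : (1 : ℂ) ∈ {ω : ℂ | ω ^ l = 1}),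
    ncard_setOf_pow_eq_one hl]

end BlockType

end Dodson1984

end Literature.NumberTheory.ComplexMultiplication

end
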